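import Summits.CriticalPhenomena.PercolationContinuityZ3.Theorems.SahiAEOrthantGluing

/-!
# The structure theorem on an arbitrary open box `∏ᵢ (aᵢ, bᵢ)`

Support file of the Sahi cell (`prim-sahi`, typer seat, generation 24; `--supports stmt-CriticalPhenomena-4575`).
Theorems only (no definitions, no named facts, no sorries).

`SahiAEOrthantCube.lean` proved the structure theorem on the open unit cube `(0,1)^ι` by transporting the theorem on
`ℝ^ι` (`exists_measurable_mtp2_version_of_ae_unbounded'`, every finite `ι`, no bounds) along the coordinatewise
sigmoid.  Here the same transport, along `xᵢ ↦ aᵢ + (bᵢ − aᵢ) σ(xᵢ)` with inverse `yᵢ ↦ logit((yᵢ − aᵢ)/(bᵢ − aᵢ))`,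
gives the theorem on every open box `W = ∏ᵢ (aᵢ, bᵢ)`, `aᵢ < bᵢ`:

* `exists_measurable_mtp2_version_of_ae_box` — `f : ℝ^ι → [0,∞]` measurable, `0 < f < ∞` a.e. on `W`, MTP₂ on
  `λ|_W ⊗ λ|_W`-almost every pair ⟹ a Borel `F`, `0 < F < ∞` on `W`, `F = 0` off `W`, `F = f` a.e. on `W`, MTP₂ at
  EVERY pair of `ℝ^ι`;
* `exists_measurable_supermodular_version_of_ae_box` — additive form: `φ` measurable and supermodular on
  `λ|_W ⊗ λ|_W`-a.e. pair ⟹ a Borel `ψ = φ` a.e. on `W`, supermodular at every pair OF `W`;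
* `exists_supermodular_clampExtension_of_box` — composing with the clamp onto a closed sub-box `K ⊆ W` gives a Borel
  function supermodular at every pair of `ℝ^ι` and `= φ` a.e. on `K` (the form used by the band theorem of
  `SahiAEBand*.lean`, where `φ` is patched outside `K` by such a function).

No sorries, no new axioms.
-/

noncomputable section

namespace Summit.CriticalPhenomena.PercolationContinuityZ3.Theorems.SahiAEFourFunctions

open MeasureTheory Set Filter Topology Function
open scoped ENNReal NNReal

variable {ι : Type*} [Fintype ι]

/-- `sigmoid (log (v * (1 - v)⁻¹)) = v` on `(0,1)`. [folklore] -/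
private theorem sigmoid_log_div₆ {v : ℝ} (hv : v ∈ Ioo (0 : ℝ) 1) : Real.sigmoid (Real.log (v * (1 - v)⁻¹)) = v := by
  have hv0 : 0 < v := hv.1
  have hv1 : 0 < 1 - v := by linarith [hv.2]
  rw [Real.sigmoid_def, Real.exp_neg, Real.exp_log (mul_pos hv0 (inv_pos.2 hv1))]
  field_simp
  ring

/-- `log (sigmoid x / (1 - sigmoid x)) = x`. [folklore] -/
private theorem log_div_sigmoid₆ (x : ℝ) : Real.log (Real.sigmoid x * (1 - Real.sigmoid x)⁻¹) = x :=
  Real.sigmoid_injective (sigmoid_log_div₆ ⟨Real.sigmoid_pos x, Real.sigmoid_lt_one x⟩)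

/-- The logit is monotone on `(0,1)`. [folklore] -/
private theorem log_div_le_log_div₆ {u v : ℝ} (hu : u ∈ Ioo (0 : ℝ) 1) (hv : v ∈ Ioo (0 : ℝ) 1) (huv : u ≤ v) :
    Real.log (u * (1 - u)⁻¹) ≤ Real.log (v * (1 - v)⁻¹) := by
  rw [← Real.sigmoid_le_iff, sigmoid_log_div₆ hu, sigmoid_log_div₆ hv]
  exact huv

omit [Fintype ι] in
/-- Membership in an open box. [folklore] -/
private theorem mem_box_iff {a b : ι → ℝ} {y : ι → ℝ} :
    y ∈ Set.pi univ (fun i => Ioo (a i) (b i)) ↔ ∀ i, a i < y i ∧ y i < b i := by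
  simp only [Set.mem_univ_pi, Set.mem_Ioo]

/-- **The structure theorem on an open box, multiplicative form**: `0 < F < ∞` on the box, `F = 0` outside, MTP₂ at
every pair of `ℝ^ι`. [this work] -/
theorem exists_measurable_mtp2_version_of_ae_box {a b : ι → ℝ} (hab : ∀ i, a i < b i)
    (f : (ι → ℝ) → ℝ≥0∞) (hf : Measurable f)
    (hfin : ∀ᵐ x ∂(volume : Measure (ι → ℝ)).restrict (Set.pi univ fun i => Ioo (a i) (b i)), f x ≠ 0 ∧ f x ≠ ∞)
    (hMTP : ∀ᵐ p : (ι → ℝ) × (ι → ℝ)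
      ∂((volume : Measure (ι → ℝ)).restrict (Set.pi univ fun i => Ioo (a i) (b i))).prod
        ((volume : Measure (ι → ℝ)).restrict (Set.pi univ fun i => Ioo (a i) (b i))),
      f p.1 * f p.2 ≤ f (p.1 ⊓ p.2) * f (p.1 ⊔ p.2)) :
    ∃ F : (ι → ℝ) → ℝ≥0∞, Measurable F ∧
      (∀ x ∈ Set.pi univ (fun i => Ioo (a i) (b i)), F x ≠ 0 ∧ F x ≠ ∞) ∧
      (∀ x ∉ Set.pi univ (fun i => Ioo (a i) (b i)), F x = 0) ∧
      F =ᵐ[(volume : Measure (ι → ℝ)).restrict (Set.pi univ fun i => Ioo (a i) (b i))] f ∧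
      ∀ x y, F x * F y ≤ F (x ⊓ y) * F (x ⊔ y) := by
  set U : Set (ι → ℝ) := Set.pi univ fun i => Ioo (a i) (b i) with hU
  have mU : MeasurableSet U := MeasurableSet.univ_pi fun _ => measurableSet_Ioo
  have hd : ∀ i, 0 < b i - a i := fun i => sub_pos.2 (hab i)
  -- the chart and its inverse
  set e : (ι → ℝ) → (ι → ℝ) := fun x i => a i + (b i - a i) * Real.sigmoid (x i) with he
  set u : (ι → ℝ) → (ι → ℝ) := fun y i => (y i - a i) * (b i - a i)⁻¹ with hu
  set L : (ι → ℝ) → (ι → ℝ) := fun y i => Real.log (u y i * (1 - u y i)⁻¹) with hL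
  have hu_mem : ∀ y ∈ U, ∀ i, u y i ∈ Ioo (0 : ℝ) 1 := fun y hy i => by
    have h := mem_box_iff.1 hy i
    refine ⟨mul_pos (sub_pos.2 h.1) (inv_pos.2 (hd i)), ?_⟩
    rw [mul_inv_lt_iff₀ (hd i), one_mul]
    linarith [h.2]
  have he_meas : Measurable e :=
    measurable_pi_iff.2 fun i => measurable_const.add
      (measurable_const.mul (continuous_sigmoid.measurable.comp (measurable_pi_apply i)))
  have hu_meas : ∀ i, Measurable fun y : ι → ℝ => u y i := fun i =>
    ((measurable_pi_apply i).sub measurable_const).mul measurable_const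
  have hL_meas : Measurable L :=
    measurable_pi_iff.2 fun i => Real.measurable_log.comp
      ((hu_meas i).mul (measurable_const.sub (hu_meas i)).inv)
  have he_mem : ∀ x, e x ∈ U := fun x => mem_box_iff.2 fun i => by
    constructor
    · show a i < a i + (b i - a i) * Real.sigmoid (x i)
      have := mul_pos (hd i) (Real.sigmoid_pos (x i)); linarith
    · show a i + (b i - a i) * Real.sigmoid (x i) < b i
      have := mul_lt_mul_of_pos_left (Real.sigmoid_lt_one (x i)) (hd i); linarith
  have hue : ∀ x i, u (e x) i = Real.sigmoid (x i) := fun x i => by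
    show (a i + (b i - a i) * Real.sigmoid (x i) - a i) * (b i - a i)⁻¹ = Real.sigmoid (x i)
    field_simp [(hd i).ne']
    ring
  have hLe : ∀ x, L (e x) = x := fun x => funext fun i => by
    show Real.log (u (e x) i * (1 - u (e x) i)⁻¹) = x i
    rw [hue, log_div_sigmoid₆ (x i)]
  have heL : ∀ y ∈ U, e (L y) = y := fun y hy => funext fun i => by
    show a i + (b i - a i) * Real.sigmoid (Real.log (u y i * (1 - u y i)⁻¹)) = y i
    rw [sigmoid_log_div₆ (hu_mem y hy i)]
    show a i + (b i - a i) * ((y i - a i) * (b i - a i)⁻¹) = y i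
    field_simp [(hd i).ne']
    ring
  have he_diff : Differentiable ℝ e :=
    differentiable_pi.2 fun i => (differentiable_const _).add
      ((differentiable_const _).mul (differentiable_sigmoid.comp (differentiable_apply i)))
  have hL_diff : DifferentiableOn ℝ L U := by
    refine differentiableOn_pi.2 fun i => ?_
    have h1 : DifferentiableOn ℝ (fun y : ι → ℝ => u y i) U :=
      (((differentiable_apply i).sub (differentiable_const _)).mul (differentiable_const _)).differentiableOn
    have h2 : DifferentiableOn ℝ (fun y : ι → ℝ => 1 - u y i) U :=
      ((differentiable_const (1 : ℝ)).differentiableOn).sub h1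
    refine (h1.mul (h2.inv fun y hy => ?_)).log fun y hy => ?_
    · have := (hu_mem y hy i).2; linarith
    · have h0 := (hu_mem y hy i).1
      have h1' : 0 < 1 - u y i := by have := (hu_mem y hy i).2; linarith
      exact (mul_pos h0 (inv_pos.2 h1')).ne'
  -- null sets both ways
  have hν : (volume : Measure (ι → ℝ)).restrict U ≪ (volume : Measure (ι → ℝ)).map e := by
    refine Measure.AbsolutelyContinuous.mk fun s hs h0 => ?_
    rw [Measure.map_apply he_meas hs] at h0
    rw [Measure.restrict_apply hs]
    have hsub : s ∩ U ⊆ e '' (e ⁻¹' s) := fun y hy => ⟨L y, by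
      show e (L y) ∈ s
      rw [heL y hy.2]; exact hy.1, heL y hy.2⟩
    exact measure_mono_null hsub
      (addHaar_image_eq_zero_of_differentiableOn_of_addHaar_eq_zero volume he_diff.differentiableOn h0)
  have hν' : (volume : Measure (ι → ℝ)).map e ≪ (volume : Measure (ι → ℝ)).restrict U := by
    refine Measure.AbsolutelyContinuous.mk fun s hs h0 => ?_
    rw [Measure.restrict_apply hs] at h0
    rw [Measure.map_apply he_meas hs]
    have hsub : e ⁻¹' s ⊆ L '' (s ∩ U) := fun x hx => ⟨e x, ⟨hx, he_mem x⟩, hLe x⟩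
    exact measure_mono_null hsub
      (addHaar_image_eq_zero_of_differentiableOn_of_addHaar_eq_zero volume
        (hL_diff.mono Set.inter_subset_right) h0)
  have hUinf : ∀ x ∈ U, ∀ y ∈ U, x ⊓ y ∈ U := fun x hx y hy => mem_box_iff.2 fun i =>
    ⟨lt_min (mem_box_iff.1 hx i).1 (mem_box_iff.1 hy i).1, (min_le_left _ _).trans_lt (mem_box_iff.1 hx i).2⟩
  have hUsup : ∀ x ∈ U, ∀ y ∈ U, x ⊔ y ∈ U := fun x hx y hy => mem_box_iff.2 fun i =>
    ⟨(mem_box_iff.1 hx i).1.trans_le (le_max_left _ _), max_lt (mem_box_iff.1 hx i).2 (mem_box_iff.1 hy i).2⟩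
  have he_mono : ∀ i, Monotone fun t : ℝ => a i + (b i - a i) * Real.sigmoid t := fun i s t hst => by
    have := mul_le_mul_of_nonneg_left (Real.sigmoid_monotone hst) (hd i).le
    simp only
    linarith
  have helat : ∀ x y, e (x ⊓ y) = e x ⊓ e y ∧ e (x ⊔ y) = e x ⊔ e y := fun x y =>
    ⟨funext fun i => (he_mono i).map_inf (x i) (y i), funext fun i => (he_mono i).map_sup (x i) (y i)⟩
  have hLlat : ∀ x ∈ U, ∀ y ∈ U, L (x ⊓ y) = L x ⊓ L y ∧ L (x ⊔ y) = L x ⊔ L y := by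
    intro x hx y hy
    have hmono : ∀ i, MonotoneOn (fun v : ℝ => Real.log ((v - a i) * (b i - a i)⁻¹ *
        (1 - (v - a i) * (b i - a i)⁻¹)⁻¹)) (Ioo (a i) (b i)) := by
      intro i s hs t ht hst
      have hs' : (s - a i) * (b i - a i)⁻¹ ∈ Ioo (0 : ℝ) 1 := by
        refine ⟨mul_pos (sub_pos.2 hs.1) (inv_pos.2 (hd i)), ?_⟩
        rw [mul_inv_lt_iff₀ (hd i), one_mul]; linarith [hs.2]
      have ht' : (t - a i) * (b i - a i)⁻¹ ∈ Ioo (0 : ℝ) 1 := by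
        refine ⟨mul_pos (sub_pos.2 ht.1) (inv_pos.2 (hd i)), ?_⟩
        rw [mul_inv_lt_iff₀ (hd i), one_mul]; linarith [ht.2]
      exact log_div_le_log_div₆ hs' ht' (mul_le_mul_of_nonneg_right (by linarith) (inv_pos.2 (hd i)).le)
    refine ⟨funext fun i => ?_, funext fun i => ?_⟩
    · exact (hmono i).map_inf (mem_box_iff.1 hx i) (mem_box_iff.1 hy i)
    · exact (hmono i).map_sup (mem_box_iff.1 hx i) (mem_box_iff.1 hy i)
  -- pull back to `ℝ^ι` and apply the structure theorem
  have hqmp : Measure.QuasiMeasurePreserving e volume ((volume : Measure (ι → ℝ)).restrict U) := ⟨he_meas, hν'⟩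
  have hqmp2 := MeasureTheory.QuasiMeasurePreserving.prodMap hqmp hqmp
  have hfin' : ∀ᵐ x ∂(volume : Measure (ι → ℝ)), f (e x) ≠ 0 ∧ f (e x) ≠ ∞ := hqmp.ae hfin
  have hMTP' : ∀ᵐ p : (ι → ℝ) × (ι → ℝ) ∂((volume : Measure (ι → ℝ)).prod volume),
      (f ∘ e) p.1 * (f ∘ e) p.2 ≤ (f ∘ e) (p.1 ⊓ p.2) * (f ∘ e) (p.1 ⊔ p.2) := by
    filter_upwards [hqmp2.ae hMTP] with p hp
    simp only [Function.comp_apply, (helat p.1 p.2).1, (helat p.1 p.2).2]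
    exact hp
  classical
  obtain ⟨F'', hF''m, hF''b, hF''ae, hF''mtp⟩ :=
    exists_measurable_mtp2_version_of_ae_unbounded' (f ∘ e) (hf.comp he_meas) hfin' hMTP'
  refine ⟨U.indicator (F'' ∘ L), (hF''m.comp hL_meas).indicator mU, fun x hx => ?_, fun x hx => ?_, ?_,
    fun x y => ?_⟩
  · rw [Set.indicator_of_mem hx]; exact hF''b (L x)
  · exact Set.indicator_of_notMem hx _
  · have h1 : ∀ᵐ x ∂(volume : Measure (ι → ℝ)), F'' (L (e x)) = f (e x) := by
      filter_upwards [hF''ae] with x hx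
      rw [hLe x]; exact hx
    have h2 : ∀ᵐ y ∂(volume : Measure (ι → ℝ)).map e, F'' (L y) = f y :=
      (ae_map_iff he_meas.aemeasurable (measurableSet_eq_fun (hF''m.comp hL_meas) hf)).2 h1
    have h3 : ∀ᵐ y ∂(volume : Measure (ι → ℝ)).restrict U, F'' (L y) = f y := hν.ae_le h2
    filter_upwards [h3, ae_restrict_mem mU] with y hy hyU
    rw [Set.indicator_of_mem hyU, Function.comp_apply, hy]
  · by_cases hx : x ∈ U
    · by_cases hy : y ∈ U
      · rw [Set.indicator_of_mem hx, Set.indicator_of_mem hy, Set.indicator_of_mem (hUinf x hx y hy),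
          Set.indicator_of_mem (hUsup x hx y hy)]
        simp only [Function.comp_apply]
        rw [(hLlat x hx y hy).1, (hLlat x hx y hy).2]
        exact hF''mtp (L x) (L y)
      · rw [Set.indicator_of_notMem hy, mul_zero]; exact zero_le
    · rw [Set.indicator_of_notMem hx, zero_mul]; exact zero_le

/-- **The structure theorem on an open box, additive form**: the version is supermodular at every pair OF the box.
[this work] -/
theorem exists_measurable_supermodular_version_of_ae_box {a b : ι → ℝ} (hab : ∀ i, a i < b i)
    (φ : (ι → ℝ) → ℝ) (hφ : Measurable φ)
    (hsm : ∀ᵐ p : (ι → ℝ) × (ι → ℝ)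
      ∂((volume : Measure (ι → ℝ)).restrict (Set.pi univ fun i => Ioo (a i) (b i))).prod
        ((volume : Measure (ι → ℝ)).restrict (Set.pi univ fun i => Ioo (a i) (b i))),
      φ p.1 + φ p.2 ≤ φ (p.1 ⊓ p.2) + φ (p.1 ⊔ p.2)) :
    ∃ ψ : (ι → ℝ) → ℝ, Measurable ψ ∧
      ψ =ᵐ[(volume : Measure (ι → ℝ)).restrict (Set.pi univ fun i => Ioo (a i) (b i))] φ ∧
      ∀ x ∈ Set.pi univ (fun i => Ioo (a i) (b i)), ∀ y ∈ Set.pi univ (fun i => Ioo (a i) (b i)),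
        ψ x + ψ y ≤ ψ (x ⊓ y) + ψ (x ⊔ y) := by
  set U : Set (ι → ℝ) := Set.pi univ fun i => Ioo (a i) (b i) with hU
  set f : (ι → ℝ) → ℝ≥0∞ := fun x => ENNReal.ofReal (Real.exp (φ x)) with hfdef
  have hfm : Measurable f := ENNReal.measurable_ofReal.comp (Real.measurable_exp.comp hφ)
  have hfin : ∀ᵐ x ∂(volume : Measure (ι → ℝ)).restrict U, f x ≠ 0 ∧ f x ≠ ∞ :=
    Eventually.of_forall fun x => ⟨(ENNReal.ofReal_pos.2 (Real.exp_pos _)).ne', ENNReal.ofReal_ne_top⟩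
  have hMTP : ∀ᵐ p : (ι → ℝ) × (ι → ℝ) ∂((volume : Measure (ι → ℝ)).restrict U).prod
      ((volume : Measure (ι → ℝ)).restrict U), f p.1 * f p.2 ≤ f (p.1 ⊓ p.2) * f (p.1 ⊔ p.2) := by
    filter_upwards [hsm] with p hp
    simp only [hfdef]
    rw [← ENNReal.ofReal_mul (Real.exp_pos _).le, ← ENNReal.ofReal_mul (Real.exp_pos _).le, ← Real.exp_add,
      ← Real.exp_add]
    exact ENNReal.ofReal_le_ofReal (Real.exp_le_exp.2 hp)
  obtain ⟨F, hFm, hFU, -, hFf, hFmtp⟩ := exists_measurable_mtp2_version_of_ae_box hab f hfm hfin hMTP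
  have hUinf : ∀ x ∈ U, ∀ y ∈ U, x ⊓ y ∈ U := fun x hx y hy => mem_box_iff.2 fun i =>
    ⟨lt_min (mem_box_iff.1 hx i).1 (mem_box_iff.1 hy i).1, (min_le_left _ _).trans_lt (mem_box_iff.1 hx i).2⟩
  have hUsup : ∀ x ∈ U, ∀ y ∈ U, x ⊔ y ∈ U := fun x hx y hy => mem_box_iff.2 fun i =>
    ⟨(mem_box_iff.1 hx i).1.trans_le (le_max_left _ _), max_lt (mem_box_iff.1 hx i).2 (mem_box_iff.1 hy i).2⟩
  have hFpos : ∀ x ∈ U, 0 < (F x).toReal := fun x hx => ENNReal.toReal_pos (hFU x hx).1 (hFU x hx).2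
  refine ⟨fun x => Real.log (F x).toReal, Real.measurable_log.comp (ENNReal.measurable_toReal.comp hFm), ?_,
    fun x hx y hy => ?_⟩
  · filter_upwards [hFf] with x hx
    show Real.log (F x).toReal = φ x
    rw [hx, hfdef, ENNReal.toReal_ofReal (Real.exp_pos _).le, Real.log_exp]
  · have h := hFmtp x y
    have hL : (F x * F y).toReal ≤ (F (x ⊓ y) * F (x ⊔ y)).toReal :=
      ENNReal.toReal_mono (ENNReal.mul_ne_top (hFU _ (hUinf x hx y hy)).2 (hFU _ (hUsup x hx y hy)).2) h
    rw [ENNReal.toReal_mul, ENNReal.toReal_mul] at hL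
    rw [← Real.log_mul (hFpos x hx).ne' (hFpos y hy).ne',
      ← Real.log_mul (hFpos _ (hUinf x hx y hy)).ne' (hFpos _ (hUsup x hx y hy)).ne']
    exact Real.log_le_log (mul_pos (hFpos x hx) (hFpos y hy)) hL

/-! ### Clamping onto a closed sub-box: everywhere-supermodular extensions -/

omit [Fintype ι] in
/-- The clamp `x ↦ (x ∨ k) ∧ k'` onto the order interval `[k, k']` is a lattice homomorphism
(distributivity of `ℝ^ι`). [folklore] -/
theorem clamp_inf (k k' x y : ι → ℝ) : ((x ⊓ y) ⊔ k) ⊓ k' = (((x ⊔ k) ⊓ k') ⊓ ((y ⊔ k) ⊓ k')) := by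
  rw [sup_inf_right, inf_inf_distrib_right]

omit [Fintype ι] in
/-- The clamp is a join homomorphism. [folklore] -/
theorem clamp_sup (k k' x y : ι → ℝ) : ((x ⊔ y) ⊔ k) ⊓ k' = (((x ⊔ k) ⊓ k') ⊔ ((y ⊔ k) ⊓ k')) := by
  rw [sup_sup_distrib_right, inf_sup_right]

omit [Fintype ι] in
/-- The clamp takes values in the order interval (for `k ≤ k'`). [folklore] -/
theorem clamp_mem_Icc {k k' : ι → ℝ} (hkk' : k ≤ k') (x : ι → ℝ) : (x ⊔ k) ⊓ k' ∈ Icc k k' :=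
  ⟨le_inf (le_sup_right) hkk', inf_le_right⟩

omit [Fintype ι] in
/-- The clamp fixes the order interval. [folklore] -/
theorem clamp_of_mem_Icc {k k' x : ι → ℝ} (hx : x ∈ Icc k k') : (x ⊔ k) ⊓ k' = x := by
  rw [sup_eq_left.2 hx.1, inf_eq_left.2 hx.2]

omit [Fintype ι] in
/-- The clamp is measurable. [folklore] -/
theorem measurable_clamp [Fintype ι] (k k' : ι → ℝ) : Measurable fun x : ι → ℝ => (x ⊔ k) ⊓ k' := by
  refine measurable_pi_iff.2 fun i => ?_
  have e : (fun x : ι → ℝ => ((x ⊔ k) ⊓ k') i) = fun x => min (max (x i) (k i)) (k' i) := by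
    funext x; simp only [Pi.inf_apply, Pi.sup_apply]
  rw [e]
  exact ((measurable_pi_apply i).max measurable_const).min measurable_const

omit [Fintype ι] in
/-- **Composing with the clamp**: a function supermodular at every pair of a set containing the order interval
`[k, k']` becomes, after composition with the clamp onto `[k, k']`, supermodular at every pair of `ℝ^ι`. [folklore] -/
theorem supermodular_comp_clamp {ψ : (ι → ℝ) → ℝ} {S : Set (ι → ℝ)} {k k' : ι → ℝ} (hkk' : k ≤ k')
    (hKS : Icc k k' ⊆ S) (hψ : ∀ x ∈ S, ∀ y ∈ S, ψ x + ψ y ≤ ψ (x ⊓ y) + ψ (x ⊔ y)) (x y : ι → ℝ) :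
    ψ ((x ⊔ k) ⊓ k') + ψ ((y ⊔ k) ⊓ k') ≤ ψ (((x ⊓ y) ⊔ k) ⊓ k') + ψ (((x ⊔ y) ⊔ k) ⊓ k') := by
  rw [clamp_inf, clamp_sup]
  exact hψ _ (hKS (clamp_mem_Icc hkk' x)) _ (hKS (clamp_mem_Icc hkk' y))

/-- **Everywhere-supermodular extension from a closed box.**  If the closed box `[k, k']` (`kᵢ < k'ᵢ`) lies in an open
box `W = ∏ᵢ (aᵢ, bᵢ)` and `φ` is measurable and supermodular on `λ|_W ⊗ λ|_W`-almost every pair, then there is a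
Borel `g : ℝ^ι → ℝ`, supermodular at EVERY pair of `ℝ^ι`, with `g = φ` almost everywhere on `[k, k']`
(`g = ψ ∘ clamp` for a version `ψ` on `W`). [this work] -/
theorem exists_supermodular_clampExtension_of_box {a b k k' : ι → ℝ} (hak : ∀ i, a i < k i) (hkk' : ∀ i, k i < k' i)
    (hkb : ∀ i, k' i < b i) (φ : (ι → ℝ) → ℝ) (hφ : Measurable φ)
    (hsm : ∀ᵐ p : (ι → ℝ) × (ι → ℝ)
      ∂((volume : Measure (ι → ℝ)).restrict (Set.pi univ fun i => Ioo (a i) (b i))).prod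
        ((volume : Measure (ι → ℝ)).restrict (Set.pi univ fun i => Ioo (a i) (b i))),
      φ p.1 + φ p.2 ≤ φ (p.1 ⊓ p.2) + φ (p.1 ⊔ p.2)) :
    ∃ g : (ι → ℝ) → ℝ, Measurable g ∧ (∀ x y, g x + g y ≤ g (x ⊓ y) + g (x ⊔ y)) ∧
      ∀ᵐ x ∂(volume : Measure (ι → ℝ)), x ∈ Icc k k' → g x = φ x := by
  have hab : ∀ i, a i < b i := fun i => ((hak i).trans (hkk' i)).trans (hkb i)
  obtain ⟨ψ, hψm, hψae, hψsm⟩ := exists_measurable_supermodular_version_of_ae_box hab φ hφ hsm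
  have hle : k ≤ k' := fun i => (hkk' i).le
  have hKW : Icc k k' ⊆ Set.pi univ (fun i => Ioo (a i) (b i)) := fun x hx =>
    Set.mem_univ_pi.2 fun i => ⟨(hak i).trans_le (hx.1 i), (hx.2 i).trans_lt (hkb i)⟩
  refine ⟨fun x => ψ ((x ⊔ k) ⊓ k'), hψm.comp (measurable_clamp k k'),
    fun x y => supermodular_comp_clamp hle hKW hψsm x y, ?_⟩
  have h1 : ∀ᵐ x ∂(volume : Measure (ι → ℝ)), x ∈ Set.pi univ (fun i => Ioo (a i) (b i)) → ψ x = φ x :=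
    (ae_restrict_iff' (MeasurableSet.univ_pi fun _ => measurableSet_Ioo)).1 hψae
  filter_upwards [h1] with x hx hxK
  show ψ ((x ⊔ k) ⊓ k') = φ x
  rw [clamp_of_mem_Icc hxK]
  exact hx (hKW hxK)

end Summit.CriticalPhenomena.PercolationContinuityZ3.Theorems.SahiAEFourFunctions
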